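import Summits.ResolutionOfSingularities.ResolutionOfSingularities.Theorems.HilbertSamuelEliminationCampaignW42Tertiary
import Summits.ResolutionOfSingularities.ResolutionOfSingularities.Theorems.HilbertSamuelEliminationCampaignW42Ridge
import Mathlib.SetTheory.Ordinal.Rank
import Mathlib.Order.WellFounded
import Mathlib.Order.Monotone.Basic
import HarnessLib

/-!
# [OURS · L1 W4.2] The tertiary-invariant slot is a faithful reformulation — sorry-free reductions for the campaign
# statements of `HilbertSamuelEliminationCampaignW42Tertiary.lean` (informal crux `TertiaryTermination`,
# stmt-ResolutionOfSingularities-17846; host route HilbertSamuelElimination; `--supports stmt-…-17846`)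

OURS (slot W4.2, prover seat res-L1-s42-pv-2); NOT statements of H. Hironaka's manuscript; AI review is weaker than
expert review. PROVED here, about the OURS decls `CampaignW42.{MarkedStage, CanonicalNearStep, Reaches, InScope,
NoNearChainFrom, TertiaryTerminationAt, TertiaryTermination, TertiaryInvariant, TertiaryInvariantExists,
GeomDirDimNonincrease}`:

* `oracleFunctional_and_admissible_regularNil` — the oracle hypotheses of the statements are satisfiable (the
  «regular schemes only» oracle), so their quantifier prefix is not vacuous.
* `InScope.init`, `InScope.step`, `InScope.of_reaches` — the scope is closed under canonical near steps;
  `InScope.pt_mem_hsStratum` — in-scope marked points lie in the `ν`-stratum; `CanonicalNearStep.isNearPoint` — hence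
  every canonical near step is a NEAR POINT in the sense of type-o1's `CampaignW42.IsNearPoint` (p465459): the two OURS
  files speak of the same points.
* `noNearChainFrom_of_tertiaryInvariant`, `tertiaryTerminationAt_of_exists` — A TERTIARY INVARIANT AT GRADE `e` PROVES THE
  GRADE-`e` KEY THEOREM (its transformation law makes `τ ∘ c` an infinite descending chain in a well-founded order).
* `TertiaryInvariant.ofTerminationAt`, `tertiaryInvariantExists_of_terminationAt`, `tertiaryInvariantExists_iff` —
  CONVERSELY the grade-`e` key theorem yields a tertiary invariant (the well-founded RANK of the in-scope grade-`e` step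
  relation, values in `Ordinal`), so `TertiaryInvariantExists p e ↔ TertiaryTerminationAt p e`: the slot is a faithful
  reformulation of the open item, neither weaker nor stronger — what remains OPEN at `e = 3` is to EXHIBIT `τ`.
* `tertiaryTerminationAt_of_tertiaryTermination`, `tertiaryTermination_of_forall` — ungraded ⇒ every grade; and every
  grade + `GeomDirDimNonincrease p` ⇒ ungraded (a non-increasing `ℕ`-valued sequence is eventually constant, so an
  infinite chain has a tail inside one grade).
* `exists_isCanonicalRunFrom_of_chain`, `canonicalSequenceInfinite_of_chain`, `noNearChainFrom_init_of_terminates` — an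
  infinite near chain from the initial marked stage yields canonical runs of every length (tree
  `CanonicalSequenceInfinite`), so TERMINATION of `S(X, ν)` (tree `CanonicalSequenceTerminates`, functional oracle)
  implies the ungraded statement at that origin: the OURS statements sit exactly between the tree's two notions.

## References

* V. Cossart, U. Jannsen, S. Saito, LNM 2270 (2020), Rem. 6.29 (1), Thm. 6.35/6.40, p. 107, App. Facts 18.28 (1).
  [CossartJannsenSaito2020]
* V. Cossart, B. Schober, Publ. RIMS 56 (2020) §1 (termination from a strictly decreasing invariant). [CossartSchober2020]
-/

noncomputable section

set_option linter.dupNamespace false -- mandated namespace of this single-conjunct summit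

open CategoryTheory AlgebraicGeometry TopologicalSpace

namespace Summit.ResolutionOfSingularities.ResolutionOfSingularities.Theorems

namespace CampaignW42

open Literature.AlgebraicGeometry.Resolution

universe u v

variable {p : ℕ} {R : ∀ S : Scheme.{u}, CentreSeq S → Prop} {N : ℕ} {ν : ℕ → ℕ}

/-! ## The oracle hypotheses are satisfiable -/

/-- THE ORACLE HYPOTHESES ARE SATISFIABLE (no vacuity in the quantifier prefix of the campaign statements): the
«regular schemes only» oracle `R₀ S t :↔ S regular ∧ t = []` is functional and admissible. With `R₀` the sequence
`S(X, ν)` runs as long as every stratum part it meets is regular (first step at an isolated origin: the point blow-up of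
`x`, CJS p. 98 Step 9) and is STUCK otherwise. [folklore] -/
theorem oracleFunctional_and_admissible_regularNil :
    OracleFunctional (fun (S : Scheme.{u}) (t : CentreSeq S) =>
        Literature.AlgebraicGeometry.Resolution.Scheme.IsRegular S ∧ t = CentreSeq.nil S) ∧
      OracleAdmissible (fun (S : Scheme.{u}) (t : CentreSeq S) =>
        Literature.AlgebraicGeometry.Resolution.Scheme.IsRegular S ∧ t = CentreSeq.nil S) := by
  refine ⟨fun S t₁ t₂ h₁ h₂ => h₁.2.trans h₂.2.symm, fun S t h => ?_⟩
  obtain ⟨hS, rfl⟩ := h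
  exact ⟨trivial, trivial, hS⟩

/-! ## The scope is closed under canonical near steps -/

/-- The initial marked stage of an isolated origin is in scope. OURS bookkeeping (slot W4.2); NOT a statement of the
manuscript. [folklore] -/
theorem InScope.init {X : Scheme.{u}} [IsLocallyNoetherian X] {x : X} (hX : IsIsolatedOrigin p N ν X x) :
    InScope p R N ν (MarkedStage.init X x) :=
  ⟨X, inferInstance, x, hX, Relation.ReflTransGen.refl⟩

/-- The scope is closed under `Reaches`. [folklore] -/
theorem InScope.of_reaches {s s' : MarkedStage.{u}} (hs : InScope p R N ν s) (h : Reaches R N ν s s') :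
    InScope p R N ν s' := by
  obtain ⟨X, hX, x, horig, hreach⟩ := hs
  exact ⟨X, hX, x, horig, hreach.trans h⟩

/-- The scope is closed under one canonical near step. [folklore] -/
theorem InScope.step {s s' : MarkedStage.{u}} (hs : InScope p R N ν s) (h : CanonicalNearStep R N ν s s') :
    InScope p R N ν s' :=
  hs.of_reaches (Relation.ReflTransGen.single h)

/-- Along a chain of canonical near steps whose start is reached from `s₀`, every term is reached from `s₀`.
[folklore] -/
theorem reaches_chain {s₀ : MarkedStage.{u}} {c : ℕ → MarkedStage.{u}} (h0 : Reaches R N ν s₀ (c 0))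
    (hstep : ∀ n, CanonicalNearStep R N ν (c n) (c (n + 1))) (n : ℕ) : Reaches R N ν s₀ (c n) := by
  induction n with
  | zero => exact h0
  | succ n ih => exact ih.tail (hstep n)

/-- Along a chain of canonical near steps from an in-scope start, every term is in scope. [folklore] -/
theorem InScope.chain {c : ℕ → MarkedStage.{u}} (h0 : InScope p R N ν (c 0))
    (hstep : ∀ n, CanonicalNearStep R N ν (c n) (c (n + 1))) (n : ℕ) : InScope p R N ν (c n) :=
  h0.of_reaches (reaches_chain Relation.ReflTransGen.refl hstep n)

/-- The marked point of the target of a canonical near step lies in the `ν`-stratum. [folklore] -/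
theorem CanonicalNearStep.pt_mem_hsStratum {s s' : MarkedStage.{u}} (h : CanonicalNearStep R N ν s s') :
    s'.pt ∈ Scheme.hsStratum s'.W N ν := by
  obtain ⟨C, P', hln, x', -, -, -, hx', rfl⟩ := h
  exact hx'

/-- The marked point of the target of a canonical near step is closed. [folklore] -/
theorem CanonicalNearStep.isClosed_pt {s s' : MarkedStage.{u}} (h : CanonicalNearStep R N ν s s') :
    IsClosed ({s'.pt} : Set s'.W) := by
  obtain ⟨C, P', hln, x', -, -, hcl, -, rfl⟩ := h
  exact hcl

/-- IN-SCOPE MARKED POINTS LIE IN THE `ν`-STRATUM (`x_n ∈ X_n(ν)`): at the origin `X(ν) = {x}`, and every step lands in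
the stratum. [folklore] -/
theorem InScope.pt_mem_hsStratum {s : MarkedStage.{u}} (hs : InScope p R N ν s) :
    s.pt ∈ Scheme.hsStratum s.W N ν := by
  obtain ⟨X, hX, x, horig, hreach⟩ := hs
  induction hreach with
  | refl =>
    show x ∈ Scheme.hsStratum X N ν
    rw [horig.stratum_eq]; exact Set.mem_singleton x
  | tail _ hlast _ => exact hlast.pt_mem_hsStratum

/-- IN-SCOPE MARKED POINTS ARE CLOSED. [folklore] -/
theorem InScope.isClosed_pt {s : MarkedStage.{u}} (hs : InScope p R N ν s) : IsClosed ({s.pt} : Set s.W) := by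
  obtain ⟨X, hX, x, horig, hreach⟩ := hs
  induction hreach with
  | refl => exact horig.isClosed
  | tail _ hlast _ => exact hlast.isClosed_pt

/-- A CANONICAL NEAR STEP IS A NEAR POINT in the sense of `CampaignW42.IsNearPoint` (type-o1, p465459): if the marked
point of `s` lies in the `ν`-stratum (e.g. `s` in scope), the marked point of `s'` is near to it along the blow-down
map `X_{n+1} → X_n`, `H^N_{X_{n+1}}(x_{n+1}) = H^N_{X_n}(x_n) = ν`. [folklore] -/
theorem CanonicalNearStep.isNearPoint {s s' : MarkedStage.{u}} (h : CanonicalNearStep R N ν s s')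
    (hs : s.pt ∈ Scheme.hsStratum s.W N ν) :
    ∃ π : s'.W ⟶ s.W, π.base s'.pt = s.pt ∧ IsNearPoint π N s'.pt := by
  obtain ⟨C, P', hln, x', -, hπ, -, hx', rfl⟩ := h
  refine ⟨blowup.π C, hπ, ?_⟩
  show Scheme.hsFun (blowup C) N x' = Scheme.hsFun s.W N ((blowup.π C).base x')
  rw [hπ]
  exact (Scheme.mem_hsStratum_iff.mp hx').trans (Scheme.mem_hsStratum_iff.mp hs).symm

/-! ## A tertiary invariant proves the grade -/

/-- `NoNearChainFrom` is antitone in the grade. [folklore] -/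
theorem NoNearChainFrom.mono {s₀ : MarkedStage.{u}} {G G' : MarkedStage.{u} → Prop}
    (h : NoNearChainFrom R N ν s₀ G) (hGG' : ∀ s, G' s → G s) : NoNearChainFrom R N ν s₀ G' := by
  rintro ⟨c, h0, hstep, hG⟩
  exact h ⟨c, h0, hstep, fun n => hGG' _ (hG n)⟩

/-- **A TERTIARY INVARIANT AT GRADE `e` EXCLUDES INFINITE NEAR CHAINS OF GRADE `e`** from every isolated origin: along
such a chain `τ` would strictly decrease for ever in a well-founded order. [folklore] -/
theorem noNearChainFrom_of_tertiaryInvariant {e : ℕ} (T : TertiaryInvariant.{u, v} p R N ν e)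
    {X : Scheme.{u}} [IsLocallyNoetherian X] {x : X} (hX : IsIsolatedOrigin p N ν X x) :
    NoNearChainFrom R N ν (MarkedStage.init X x) fun s => s.geomDirDim = e := by
  rintro ⟨c, h0, hstep, hgrade⟩
  have hsc : ∀ n, InScope p R N ν (c n) :=
    InScope.chain ((InScope.init hX).of_reaches h0) hstep
  letI : Preorder T.ι := T.pre
  haveI : WellFoundedLT T.ι := T.wf
  have hdec : ∀ n, T.τ (c (n + 1)) < T.τ (c n) := fun n =>
    T.decr (c n) (c (n + 1)) (hsc n) (hstep n) (hgrade n) (hgrade (n + 1))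
  exact (wellFounded_iff_isEmpty_descending_chain.mp (wellFounded_lt (α := T.ι))).false
    ⟨fun n => T.τ (c n), hdec⟩

/-- **`TertiaryInvariantExists p e → TertiaryTerminationAt p e`**: exhibiting a tertiary invariant at grade `e` (for all
admissible functional oracles, levels and values) proves the grade-`e` key theorem. [folklore] -/
theorem tertiaryTerminationAt_of_exists {e : ℕ} (h : TertiaryInvariantExists.{u, v} p e) :
    TertiaryTerminationAt.{u} p e := by
  intro R hRf hRa N ν X _ x hX
  obtain ⟨T⟩ := h R hRf hRa N ν
  exact noNearChainFrom_of_tertiaryInvariant T hX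

/-! ## Conversely: the grade-`e` key theorem yields a tertiary invariant (well-founded rank) -/

/-- The IN-SCOPE GRADE-`e` STEP RELATION, transposed for well-foundedness: `gradeRel e s' s` iff `s` is in scope,
`s → s'` is a canonical near step, and both ends have geometric directrix dimension `e`. [folklore] -/
def gradeRel (p : ℕ) (R : ∀ S : Scheme.{u}, CentreSeq S → Prop) (N : ℕ) (ν : ℕ → ℕ) (e : ℕ)
    (s' s : MarkedStage.{u}) : Prop :=
  InScope p R N ν s ∧ CanonicalNearStep R N ν s s' ∧ s.geomDirDim = e ∧ s'.geomDirDim = e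

/-- The grade-`e` key theorem (for the given oracle, level and value, at every isolated origin) makes the in-scope
grade-`e` step relation WELL-FOUNDED: a descending chain would be an infinite near chain of grade `e` from the origin
of its first term. [folklore] -/
theorem wellFounded_gradeRel {e : ℕ}
    (h : ∀ (X : Scheme.{u}) [IsLocallyNoetherian X] (x : X), IsIsolatedOrigin p N ν X x →
      NoNearChainFrom R N ν (MarkedStage.init X x) fun s => s.geomDirDim = e) :
    WellFounded (gradeRel p R N ν e) := by
  refine wellFounded_iff_isEmpty_descending_chain.mpr ⟨fun ⟨f, hf⟩ => ?_⟩
  obtain ⟨X, hX, x, horig, hreach⟩ := (hf 0).1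
  exact @h X hX x horig ⟨f, hreach, fun n => (hf n).2.1, fun n => (hf n).2.2.1⟩

/-- **THE RANK INVARIANT**: from the grade-`e` key theorem, the well-founded rank of the in-scope grade-`e` step
relation is a tertiary invariant at grade `e` (values in `Ordinal`). This is the abstract converse; it says nothing
about computing `τ` from the characteristic polyhedron. [folklore] -/
def TertiaryInvariant.ofTerminationAt {e : ℕ}
    (h : ∀ (X : Scheme.{u}) [IsLocallyNoetherian X] (x : X), IsIsolatedOrigin p N ν X x →
      NoNearChainFrom R N ν (MarkedStage.init X x) fun s => s.geomDirDim = e) :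
    TertiaryInvariant.{u, u + 2} p R N ν e :=
  haveI : IsWellFounded MarkedStage.{u} (gradeRel p R N ν e) := ⟨wellFounded_gradeRel h⟩
  { ι := Ordinal.{u + 1}
    pre := inferInstance
    wf := inferInstance
    τ := IsWellFounded.rank (gradeRel p R N ν e)
    decr := fun _ _ hs hss' hse hs'e =>
      IsWellFounded.rank_lt_of_rel (r := gradeRel p R N ν e) ⟨hs, hss', hse, hs'e⟩ }

/-- **`TertiaryTerminationAt p e → TertiaryInvariantExists p e`** (values in `Ordinal.{u+1}`). [folklore] -/
theorem tertiaryInvariantExists_of_terminationAt {e : ℕ} (h : TertiaryTerminationAt.{u} p e) :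
    TertiaryInvariantExists.{u, u + 2} p e :=
  fun R hRf hRa N ν => ⟨TertiaryInvariant.ofTerminationAt fun X _ x hX => h R hRf hRa N ν X x hX⟩

/-- **THE SLOT IS A FAITHFUL REFORMULATION: `TertiaryInvariantExists p e ↔ TertiaryTerminationAt p e`** (for the value
universe large enough to hold `Ordinal.{u+1}`; `→` holds for every value universe, `tertiaryTerminationAt_of_exists`).
So the open item at `e = 3` is neither weakened nor strengthened by its slot form; what the slot adds is the SHAPE of a
solution — a function `τ` with a transformation law. [folklore] -/
theorem tertiaryInvariantExists_iff {e : ℕ} :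
    TertiaryInvariantExists.{u, u + 2} p e ↔ TertiaryTerminationAt.{u} p e :=
  ⟨tertiaryTerminationAt_of_exists, tertiaryInvariantExists_of_terminationAt⟩

/-! ## Grades: ungraded ⇒ graded; all grades + monotonicity of `ē` ⇒ ungraded -/

/-- The ungraded statement implies every graded one. [folklore] -/
theorem tertiaryTerminationAt_of_tertiaryTermination (h : TertiaryTermination.{u} p) (e : ℕ) :
    TertiaryTerminationAt.{u} p e :=
  fun R hRf hRa N ν X _ x hX => (h R hRf hRa N ν X x hX).mono fun _ _ => trivial

/-- A sequence in `ℕ` with `g (n+1) ≤ g n` is eventually constant: from some `n₀` on it equals `g n₀`. [folklore] -/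
theorem eventually_const_of_succ_le {g : ℕ → ℕ} (hg : ∀ n, g (n + 1) ≤ g n) :
    ∃ n₀, ∀ n, g (n₀ + n) = g n₀ := by
  have hanti : Antitone g := antitone_nat_of_succ_le hg
  refine ⟨Function.argmin g, fun n => le_antisymm (hanti (Nat.le_add_right _ _)) ?_⟩
  exact le_of_not_gt (Function.not_lt_argmin g _)

/-- **ASSEMBLY OVER THE GRADES**: if `ē` does not increase along canonical near steps (`GeomDirDimNonincrease p`, CJS
Thm. 3.10 (4) for the canonical centres) then the graded key theorems for all grades `e` give the ungraded statement —
an infinite near chain has `ē` eventually constant, and its tail is an infinite chain inside one grade. [folklore] -/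
theorem tertiaryTermination_of_forall (hmono : GeomDirDimNonincrease.{u} p)
    (h : ∀ e, TertiaryTerminationAt.{u} p e) : TertiaryTermination.{u} p := by
  intro R hRf hRa N ν X _ x hX
  rintro ⟨c, h0, hstep, -⟩
  have hsc : ∀ n, InScope p R N ν (c n) :=
    InScope.chain ((InScope.init hX).of_reaches h0) hstep
  have hg : ∀ n, (c (n + 1)).geomDirDim ≤ (c n).geomDirDim := fun n =>
    hmono R hRf hRa N ν (c n) (c (n + 1)) (hsc n) (hstep n)
  obtain ⟨n₀, hn₀⟩ := eventually_const_of_succ_le (g := fun n => (c n).geomDirDim) hg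
  refine h (c n₀).geomDirDim R hRf hRa N ν X x hX ⟨fun n => c (n₀ + n), ?_, ?_, ?_⟩
  · exact reaches_chain h0 hstep n₀
  · intro n
    exact hstep (n₀ + n)
  · intro n
    exact hn₀ n

/-! ## Link with the tree's `CanonicalSequenceInfinite` / `CanonicalSequenceTerminates` -/

/-- From a chain of canonical near steps starting AT `s₀`, canonical runs of every length from the state of `s₀` (the
centres of the chain). [folklore] -/
theorem exists_isCanonicalRunFrom_of_chain (n : ℕ) :
    ∀ (s₀ : MarkedStage.{u}) (c : ℕ → MarkedStage.{u}), c 0 = s₀ →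
      (∀ k, CanonicalNearStep R N ν (c k) (c (k + 1))) →
      ∃ s : CentreSeq s₀.W, IsCanonicalRunFrom R N ν s₀.L s₀.P s ∧ s.length = n := by
  induction n with
  | zero => exact fun s₀ _ _ _ => ⟨CentreSeq.nil _, trivial, rfl⟩
  | succ n ih =>
    intro s₀ c hc0 hstep
    subst hc0
    obtain ⟨C, P', hln, x', hst, hπ, hcl, hx', h1⟩ := hstep 0
    obtain ⟨s, hs, hlen⟩ :=
      ih ⟨blowup C, hln, (c 0).L.next (Scheme.hsStratum (c 0).W N ν) C, P', x'⟩ (fun k => c (k + 1)) h1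
        fun k => hstep (k + 1)
    exact ⟨CentreSeq.cons C s, ⟨P', hst, hs⟩, by simp [hlen]⟩

/-- **AN INFINITE NEAR CHAIN FROM THE INITIAL MARKED STAGE MAKES `S(X, ν)` INFINITE** (tree `CanonicalSequenceInfinite`:
initial segments of every length). [folklore] -/
theorem canonicalSequenceInfinite_of_chain {X : Scheme.{u}} [IsLocallyNoetherian X] {x : X}
    {c : ℕ → MarkedStage.{u}} (hc0 : c 0 = MarkedStage.init X x)
    (hstep : ∀ k, CanonicalNearStep R N ν (c k) (c (k + 1))) : CanonicalSequenceInfinite R N ν X := by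
  intro n
  obtain ⟨s, hs, hlen⟩ := exists_isCanonicalRunFrom_of_chain n (MarkedStage.init X x) c hc0 hstep
  exact ⟨s, hs, hlen⟩

/-- **TERMINATION OF `S(X, ν)` IMPLIES THE UNGRADED STATEMENT AT THAT ORIGIN, for chains starting at the initial marked
stage** (functional oracle; tree `CanonicalSequenceTerminates.not_infinite`). The converse direction — no infinite near
chain ⇒ no infinite `S(X, ν)` — is the compactness (König) step over the proper exceptional fibres, not proved here.
[folklore] -/
theorem noNearChain_init_of_terminates (hRf : OracleFunctional R) {X : Scheme.{u}} [IsLocallyNoetherian X] {x : X}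
    (hterm : CanonicalSequenceTerminates R N ν X) (G : MarkedStage.{u} → Prop) :
    ¬ ∃ c : ℕ → MarkedStage.{u}, c 0 = MarkedStage.init X x ∧
      (∀ n, CanonicalNearStep R N ν (c n) (c (n + 1))) ∧ ∀ n, G (c n) := by
  rintro ⟨c, hc0, hstep, -⟩
  exact hterm.not_infinite hRf (canonicalSequenceInfinite_of_chain hc0 hstep)

end CampaignW42

end Summit.ResolutionOfSingularities.ResolutionOfSingularities.Theorems

end
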